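/-
Copyright: cell `pub-ymgap` (HUMAN RULING D-0062), Track A of `YM-PLAN.md`, DAG node N20 (= NE7b); R134 acceleration seat
`pub-ymgap-dag-n20-c` (strategy s1, generation 3), module 12.  Released under the licence of the surrounding project.
-/
import Summits.QuantumFields.YangMills.Theorems.BalabanUVNodesN20LCSRestrictedDoubling
import Summits.QuantumFields.YangMills.Theorems.BalabanUVNodesN20LCSRestrictedChessboardCubes
import HarnessLib

/-!
# YM-DAG node N20 (= NE7b), strategy s1, module 12: CONDITIONAL «LCS-0» — local exponential moments of cube energies in the
# small-field-RESTRICTED level-0 state of record are `≤ e^{C·a·#S}` uniformly in the coupling and the volume (the junction of module 10c's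
# restricted doubling with module 11's restricted chessboard through module 7's dictionary)

Track A of `YM-PLAN.md` (cell `pub-ymgap`, HUMAN RULING D-0062), node **N20** = spine estimate NE7b (`T4WeightBudget.RelWeightBound` — the
cell `pub-balaban`'s OWN estimate, NOT PRINTED in [Bałaban 1983–89], NOT PROVED).  Seat `pub-ymgap-dag-n20-c` (R134, s1), module 12
(modules 10a–c `…N20LCSRestrictedDoubling*`: restricted uniform doubling and the restricted action moment, host currency; modules 11a–b
`…N20LCSRestrictedChessboard{,Cubes}`: the chessboard for the weighted level-0 state of record and the cube-energy family; module 7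
`…N20LCSAtRecordLevelZero`: the unrestricted rung 0 at the record and the dictionary).  Kernel theorems only: 0 `def`, 0 `sorry`, standard
axioms; COUNT-NEUTRAL; `--supports` the K3′ item `SpineGivenEndpointR12` (stmt-QuantumFields-19908) as a helper.  Nothing of Bałaban's is
asserted: the objects are the cell's `Missing.expect ∕ GaugeField.plaqHol ∕ reTr ∕ Plaq` on `T^{(0)}` of a `d = 4` parameter set, `SU(N)`, and
the host's `wilsonAction ∕ WilsonRP.plaqRe ∕ haarProbability`, read BY NAME through `ofConfig ∕ plaqEquiv` (`GibbsMeasureWilsonDictionary`).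

WHY.  The seat's triage located «LCS-j» at levels `≥ 1` (the residual of Bałaban's kind on row NE7b's re-cut road,
`Spine/NE7b/LocalConditionalStability.LocCondStability`) as a local exponential-moment bound in the HISTORY TERM's own state, i.e. for the
Wilson weight RESTRICTED by the earlier steps' small-field characteristic functions, and split it into (ii)(b) a chessboard for the restricted
state and (ii)(c) a β-uniform global input (restricted uniform doubling).  Both are now kernel theorems (modules 11, 10); THIS FILE joins them:
the conditional, β-UNIFORM, volume-uniform local stability inequality at level 0 for the all-plaquette small-field restriction.

WHAT IS PROVED ([folklore]: dictionary bookkeeping, Bochner ↔ Lebesgue integrals, counting):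
* §1 `tilt_smallField_ofConfig`, `smallField_ofConfig` (through `ofConfig` the cell's action `Σ_p(1 − Re tr U(∂p))` is `N⁻¹·` the host's
  Wilson action of the fundamental representation and the cell's threshold `ε` is the host's `Nε`), ★ **`expect_restricted_actionMoment_le`** —
  `∃ A c > 0, ∀ P (d = 4), β ≥ 4N, βε ≥ c, 0 ≤ a ≤ ½:
   ⟨e^{aβΣ_p(1 − Re tr U(∂p))}·∏_p 𝟙[1 − Re tr U(∂p) ≤ ε]⟩_{P,β} ≤ e^{2aA·N₀⁴}·⟨∏_p 𝟙[…]⟩_{P,β}` (module 10c's `restricted_actionMoment_le` at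
  host coupling `β∕N`, via `integral_gibbsMeasure_eq_expect`, `integral_gibbsMeasure_eq_integral_wilsonMeasure`, `wilsonExpectation_eq_integral_div`,
  `integral_eq_lintegral_of_nonneg_ae`).
* §2 `card_cubes_le` (a plaquette lies in `≤ 2^d` closed unit cubes), `sum_cubeEnergy_le` (`Σ_c E_c ≤ 2^d·Σ_p (1 − Re tr U(∂p))`).
* §3 ★★ **`condLCS_exp_cubeEnergy`** — `∃ C c > 0, ∀ P (d = 4), β ≥ 4N, βε ≥ c, 0 ≤ t ≤ β∕32`, if the restricted state is non-null then for
  every finite set `S` of closed unit cubes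
  `⟨∏_{c∈S} e^{tE_c}·∏_p 𝟙[1 − Re tr U(∂p) ≤ ε]⟩_{P,β} ∕ ⟨∏_p 𝟙[…]⟩_{P,β} ≤ exp(C·(t∕β)·#S)`,
  `E_c = Σ_{p ⊂ [c,c+1]^4}(1 − Re tr U(∂p))`: local exponential moments of plaquette energies at the natural scale `1∕β`, CONDITIONED on the
  global small-field event, cost `e^{O(1)}` per unit cube, uniformly in `β` and in the volume — the conditional twin of module 7's
  `localExpMoment_gibbsMeasure` (chessboard 11b + `sum_cubeEnergy_le` + §1 at `a = 16t∕β`).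

HONEST FRAMING.  Level 0 only, ONE threshold on ALL plaquettes (the leading, all-small history; histories with large-field regions break the
reflection symmetry and are NOT covered), the restricted state's non-nullity is a hypothesis (it follows from module 10b's restricted lower
bound; not re-derived here), `d = 4`, `SU(N)`, `β ≥ 4N`, `βε ≥ c(N)`, `t ≤ β∕32`; the plaquette-set form (`A_p ≤ E_{x(p)}`) and the
`LocCondStability`-currency reading (integrability conjunct, history-term density) are routine corollaries left to the successor; levels `≥ 1`
(push-forward along Bałaban's averaging, residual (i) = the domination letter, seat n20-d), (iv) (A1c) untouched.  NE7b NOT PRINTED ∕ NOT PROVED;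
(α)-instance 0∕1; N20 NOT discharged; typed 28∕28, discharged count untouched; NOT ℝ⁴, NOT infinite volume, NOT OS axioms, NOT a mass gap,
NOT Clay.
-/

set_option autoImplicit false

noncomputable section

namespace Summit.QuantumFields.YangMills.BalabanUVNodes.N20LCSConditional

open MeasureTheory Finset
open Literature.MathematicalPhysics.QuantumFieldTheory
open Literature.MathematicalPhysics.QuantumFieldTheory.Balaban1983to89
open Literature.MathematicalPhysics.QuantumLattice (fundamentalRep continuous_fundamentalRep fundamentalRep_injective
  fundamentalRep_mem_unitaryGroup)
open Literature.Barriers.CriticalPhenomena.NonGibbs (BlockIdx)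
open Summit.QuantumFields.YangMills.BalabanUVNodes.N20LCSAtRecordLevelZero (plaqEnergy_ofConfig)
open Summit.QuantumFields.YangMills.BalabanUVNodes.N20LCSRestrictedDoubling (restricted_actionMoment_le restrictedPF_ne_top
  smallField_nonneg_le_one)
open Summit.QuantumFields.YangMills.BalabanUVNodes.N20LCSRestrictedChessboard (chessboard_exp_cubeEnergy expect_mul_prod_mono
  expect_mul_prod_nonneg cubeEnergy_mem measurable_cubeEnergy)

variable {N : ℕ} [NeZero N]

/-! ## §1 The junction with the host: the restricted GLOBAL exponential moment of the action AT THE RECORD -/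

section Global

/-- The dictionary for the restricted weight and the tilted carrier: read through `ofConfig`, the cell's action `Σ_p (1 − Re tr U(∂p))` is
`N⁻¹` times the host's Wilson action of the fundamental representation, and the cell's all-plaquette small-field characteristic function at
threshold `ε` is the host's at threshold `N·ε` (`plaqEnergy_ofConfig`, `plaqEquiv`). [folklore] -/
theorem tilt_smallField_ofConfig (P : Params) (s ε : ℝ) (V : GaugeConfig P.d (P.sitesPerDir 0) (Matrix.specialUnitaryGroup (Fin N) ℂ)) :
    Real.exp (s * ∑ p : Plaq P 0, (1 - reTr (GaugeField.plaqHol (ofConfig V) p))) *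
        (∏ p : Plaq P 0, (if 1 - reTr (GaugeField.plaqHol (ofConfig V) p) ≤ ε then (1 : ℝ) else 0)) =
      Real.exp (s / N * wilsonAction (fundamentalRep (Fin N)) V) *
        ∏ q : Plaquette P.d (P.sitesPerDir 0),
          (if (N : ℝ) - WilsonRP.plaqRe (fundamentalRep (Fin N)) V q ≤ N * ε then (1 : ℝ) else 0) := by
  have hN : (0 : ℝ) < N := Nat.cast_pos.mpr (Nat.pos_of_ne_zero (NeZero.ne N))
  have hplaq : ∀ p : Plaq P 0, 1 - reTr (GaugeField.plaqHol (ofConfig V) p) =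
      ((N : ℝ) - WilsonRP.plaqRe (fundamentalRep (Fin N)) V (plaqEquiv 0 p)) / N := fun p => by
    rw [plaqEnergy_ofConfig P V p, mul_div_cancel_left₀ _ hN.ne']
  congr 1
  · congr 1
    simp_rw [hplaq]
    rw [← Finset.sum_div, Fintype.sum_equiv (plaqEquiv 0) _
      (fun q : Plaquette P.d (P.sitesPerDir 0) => (N : ℝ) - WilsonRP.plaqRe (fundamentalRep (Fin N)) V q) fun p => rfl]
    show s * ((∑ q : Plaquette P.d (P.sitesPerDir 0), ((N : ℝ) - WilsonRP.plaqRe (fundamentalRep (Fin N)) V q)) / N) =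
      s / N * wilsonAction (fundamentalRep (Fin N)) V
    rw [show wilsonAction (fundamentalRep (Fin N)) V =
      ∑ q : Plaquette P.d (P.sitesPerDir 0), ((N : ℝ) - WilsonRP.plaqRe (fundamentalRep (Fin N)) V q) from rfl]
    ring
  · refine Fintype.prod_equiv (plaqEquiv 0) _ _ fun p => ?_
    simp_rw [hplaq]
    exact if_congr (div_le_iff₀ hN |>.trans (by rw [mul_comm])) rfl rfl

/-- The same for the weight alone (`s = 0`). [folklore] -/
theorem smallField_ofConfig (P : Params) (ε : ℝ) (V : GaugeConfig P.d (P.sitesPerDir 0) (Matrix.specialUnitaryGroup (Fin N) ℂ)) :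
    (∏ p : Plaq P 0, (if 1 - reTr (GaugeField.plaqHol (ofConfig V) p) ≤ ε then (1 : ℝ) else 0)) =
      ∏ q : Plaquette P.d (P.sitesPerDir 0),
        (if (N : ℝ) - WilsonRP.plaqRe (fundamentalRep (Fin N)) V q ≤ N * ε then (1 : ℝ) else 0) := by
  have h := tilt_smallField_ofConfig (N := N) P 0 ε V
  simpa only [zero_mul, zero_div, Real.exp_zero, one_mul] using h

/-- **THE RESTRICTED GLOBAL EXPONENTIAL MOMENT OF THE ACTION AT THE RECORD.**  There are `A = A(N)` and `c = c(N) > 0` such that for every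
`d = 4` parameter set `P` (torus `T^{(0)}` of side `N₀ = 2L^{m+K}`), every coupling `β ≥ 4N`, every small-field threshold `ε` with `βε ≥ c` and
every `0 ≤ a ≤ ½`:

  `⟨e^{aβ·Σ_p(1 − Re tr U(∂p))} · ∏_p 𝟙[1 − Re tr U(∂p) ≤ ε]⟩_{P,β} ≤ e^{2aA·N₀⁴} · ⟨∏_p 𝟙[1 − Re tr U(∂p) ≤ ε]⟩_{P,β}`

— in the small-field-RESTRICTED level-0 state the whole action has exponential moments at the fraction `a` of the coupling with a cost linear in
the volume and UNIFORM in `β` (module 10c's `restricted_actionMoment_le` for the fundamental representation of `SU(N)` at the host coupling `β∕N`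
and host threshold `Nε`, through the dictionary `integral_gibbsMeasure_eq_integral_wilsonMeasure` ∕ `wilsonExpectation_eq_integral_div`). [folklore] -/
theorem expect_restricted_actionMoment_le (N : ℕ) [NeZero N] :
    ∃ A c : ℝ, 0 < c ∧ ∀ (P : Params), P.d = 4 → ∀ (β ε a : ℝ), 4 * N ≤ β → c ≤ β * ε → 0 ≤ a → a ≤ 1 / 2 →
      Missing.expect (G := Matrix.specialUnitaryGroup (Fin N) ℂ) P β
          (fun U => Real.exp (a * β * ∑ p : Plaq P 0, (1 - reTr (GaugeField.plaqHol U p))) *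
            ∏ p : Plaq P 0, (if 1 - reTr (GaugeField.plaqHol U p) ≤ ε then (1 : ℝ) else 0)) ≤
        Real.exp (2 * a * A * (P.sitesPerDir 0 : ℝ) ^ 4) *
          Missing.expect (G := Matrix.specialUnitaryGroup (Fin N) ℂ) P β
            (fun U => ∏ p : Plaq P 0, (if 1 - reTr (GaugeField.plaqHol U p) ≤ ε then (1 : ℝ) else 0)) := by
  -- the fundamental representation of `SU(N)` as a faithful unitary lattice representation of the host
  let r : LatticeRep (Matrix.specialUnitaryGroup (Fin N) ℂ) :=
    ⟨N, fundamentalRep (Fin N), continuous_fundamentalRep (Fin N), fundamentalRep_injective (Fin N), fundamentalRep_mem_unitaryGroup⟩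
  obtain ⟨A, c, hc, hmom⟩ := restricted_actionMoment_le r
  refine ⟨A, c, hc, fun P hd β ε a hβ hcε ha0 ha => ?_⟩
  obtain ⟨d, L, m, K, hd1, hL⟩ := P
  simp only at hd
  subst hd
  set P : Params := ⟨4, L, m, K, hd1, hL⟩ with hP
  have hNpos : (0 : ℝ) < N := Nat.cast_pos.mpr (Nat.pos_of_ne_zero (NeZero.ne N))
  have hβ0 : 0 ≤ β := le_trans (by positivity) hβ
  have hb : 4 ≤ β / N := by rwa [le_div_iff₀ hNpos]
  have hL2 : 2 ≤ P.sitesPerDir 0 := by have := P.one_lt_sitesPerDir 0; omega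
  have hbε : c ≤ β / N * (N * ε) := by
    rwa [show β / N * (N * ε) = β * ε by field_simp]
  -- host notation
  set μ : Measure (GaugeConfig 4 (P.sitesPerDir 0) (Matrix.specialUnitaryGroup (Fin N) ℂ)) :=
    Measure.pi fun _ : Edge 4 (P.sitesPerDir 0) => haarProbability (Matrix.specialUnitaryGroup (Fin N) ℂ) with hμ
  set S : GaugeConfig 4 (P.sitesPerDir 0) (Matrix.specialUnitaryGroup (Fin N) ℂ) → ℝ := fun V => wilsonAction (fundamentalRep (Fin N)) V
    with hS
  set D : GaugeConfig 4 (P.sitesPerDir 0) (Matrix.specialUnitaryGroup (Fin N) ℂ) → ℝ := fun V =>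
    ∏ q : Plaquette 4 (P.sitesPerDir 0), (if (N : ℝ) - WilsonRP.plaqRe (fundamentalRep (Fin N)) V q ≤ N * ε then (1 : ℝ) else 0) with hD
  have hD01 : ∀ V, 0 ≤ D V ∧ D V ≤ 1 := fun V => smallField_nonneg_le_one (fundamentalRep (Fin N)) (N * ε) V
  -- both expectations as host integrals against `e^{−(β/N)S} dHaar`, common denominator
  have hden : 0 < ∫ V, Real.exp (-(β / N) * S V) ∂μ := by
    have h := Summit.QuantumFields.YangMills.Theorems.FemtoCurvatureTwoPoint.PlaquetteVariance.partitionFunction_toReal_pos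
      (d := 4) (L := P.sitesPerDir 0) (fundamentalRep (Fin N)) (continuous_fundamentalRep (Fin N)) (β / N)
    rwa [Summit.QuantumFields.YangMills.Theorems.FemtoCurvatureTwoPointC.OneSite.partitionFunction_eq_lintegral',
      ← integral_eq_lintegral_of_nonneg_ae (ae_of_all _ fun V => (Real.exp_pos _).le)
      ((Real.measurable_exp.comp ((WilsonRP.measurable_wilsonAction (fundamentalRep (Fin N))
        (continuous_fundamentalRep (Fin N))).const_mul _)).aestronglyMeasurable)] at h
  have hexpect : ∀ F : GaugeField P 0 (Matrix.specialUnitaryGroup (Fin N) ℂ) → ℝ,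
      Missing.expect (G := Matrix.specialUnitaryGroup (Fin N) ℂ) P β F =
        (∫ V, F (ofConfig V) * Real.exp (-(β / N) * S V) ∂μ) / ∫ V, Real.exp (-(β / N) * S V) ∂μ := by
    intro F
    rw [← T4GenFunBounds.integral_gibbsMeasure_eq_expect P hβ0,
      GibbsMeasureWilsonDictionary.integral_gibbsMeasure_eq_integral_wilsonMeasure P hβ0]
    exact wilsonExpectation_eq_integral_div (fundamentalRep (Fin N)) (continuous_fundamentalRep (Fin N)) (β / N) _
  rw [hexpect, hexpect, ← mul_div_assoc]
  refine div_le_div_of_nonneg_right ?_ hden.le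
  -- the two numerators in host words
  have hnum : ∀ V : GaugeConfig 4 (P.sitesPerDir 0) (Matrix.specialUnitaryGroup (Fin N) ℂ),
      (Real.exp (a * β * ∑ p : Plaq P 0, (1 - reTr (GaugeField.plaqHol (ofConfig V) p))) *
          ∏ p : Plaq P 0, (if 1 - reTr (GaugeField.plaqHol (ofConfig V) p) ≤ ε then (1 : ℝ) else 0)) *
        Real.exp (-(β / N) * S V) =
      Real.exp (a * (β / N) * S V) * (Real.exp (-(β / N) * S V) * D V) := by
    intro V
    rw [tilt_smallField_ofConfig P (a * β) ε V, hS, hD]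
    simp only []
    rw [show a * β / N = a * (β / N) by ring]
    ring
  have hden' : ∀ V : GaugeConfig 4 (P.sitesPerDir 0) (Matrix.specialUnitaryGroup (Fin N) ℂ),
      (∏ p : Plaq P 0, (if 1 - reTr (GaugeField.plaqHol (ofConfig V) p) ≤ ε then (1 : ℝ) else 0)) * Real.exp (-(β / N) * S V) =
        Real.exp (-(β / N) * S V) * D V := by
    intro V
    rw [smallField_ofConfig P ε V, hD, mul_comm]
  simp_rw [hnum, hden']
  -- measurability, non-negativity, and the passage to lower Lebesgue integrals
  have hSm : Measurable S := WilsonRP.measurable_wilsonAction (fundamentalRep (Fin N)) (continuous_fundamentalRep (Fin N))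
  have hwm : Measurable fun V : GaugeConfig 4 (P.sitesPerDir 0) (Matrix.specialUnitaryGroup (Fin N) ℂ) =>
      Real.exp (-(β / N) * S V) * D V := by
    refine (Real.measurable_exp.comp (hSm.const_mul _)).mul (Finset.measurable_prod _ fun q _ => ?_)
    exact Measurable.ite (measurableSet_le (measurable_const.sub (WilsonRP.measurable_plaqRe (fundamentalRep (Fin N))
      (continuous_fundamentalRep (Fin N)) q)) measurable_const) measurable_const measurable_const
  have hw0 : ∀ V, 0 ≤ Real.exp (-(β / N) * S V) * D V := fun V => mul_nonneg (Real.exp_pos _).le (hD01 V).1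
  have hleft : ∫ V, Real.exp (a * (β / N) * S V) * (Real.exp (-(β / N) * S V) * D V) ∂μ =
      (∫⁻ V, ENNReal.ofReal (Real.exp (a * (β / N) * S V) * (Real.exp (-(β / N) * S V) * D V)) ∂μ).toReal :=
    integral_eq_lintegral_of_nonneg_ae (ae_of_all _ fun V => mul_nonneg (Real.exp_pos _).le (hw0 V))
      (((Real.measurable_exp.comp (hSm.const_mul _)).mul hwm).aestronglyMeasurable)
  have hright : ∫ V, Real.exp (-(β / N) * S V) * D V ∂μ =
      (∫⁻ V, ENNReal.ofReal (Real.exp (-(β / N) * S V) * D V) ∂μ).toReal :=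
    integral_eq_lintegral_of_nonneg_ae (ae_of_all _ hw0) hwm.aestronglyMeasurable
  rw [hleft, hright]
  -- module 10c's restricted exponential moment of the action, in real numbers
  have h10 := hmom (P.sitesPerDir 0) (β / N) (N * ε) a hL2 hb hbε ha0 ha
  have htop : (∫⁻ V, ENNReal.ofReal (Real.exp (-(β / N) * S V) * D V) ∂μ) ≠ ⊤ := restrictedPF_ne_top r (β / N) (N * ε)
  have hfin : ENNReal.ofReal (Real.exp (2 * a * A * ((P.sitesPerDir 0 : ℕ) : ℝ) ^ 4)) *
      (∫⁻ V, ENNReal.ofReal (Real.exp (-(β / N) * S V) * D V) ∂μ) ≠ ⊤ := ENNReal.mul_ne_top ENNReal.ofReal_ne_top htop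
  have hreal := ENNReal.toReal_mono hfin h10
  rw [ENNReal.toReal_mul, ENNReal.toReal_ofReal (Real.exp_pos _).le] at hreal
  exact hreal

end Global

/-! ## §2 Every plaquette lies in at most `2^d` closed unit cubes: `Σ_c E_c ≤ 2^d · Σ_p (1 − Re tr U(∂p))` -/

section Count

variable {P : Params}

/-- A plaquette lies in at most `2^d` closed unit cubes (the lower corner is determined by the set of coordinates at which it agrees with
the plaquette's base point). [folklore] -/
theorem card_cubes_le (p : Plaq P 0) :
    (Finset.univ.filter fun c : BlockIdx P.d (P.sitesPerDir 0) =>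
        ∀ κ, p.src κ = c κ ∨ (κ ≠ p.μ ∧ κ ≠ p.ν ∧ p.src κ = c κ + 1)).card ≤ 2 ^ P.d := by
  classical
  have hcard : (Finset.univ : Finset (Fin P.d → Bool)).card = 2 ^ P.d := by
    rw [Finset.card_univ, Fintype.card_fun, Fintype.card_bool, Fintype.card_fin]
  rw [← hcard]
  refine Finset.card_le_card_of_injOn (fun c κ => decide (p.src κ = c κ)) (fun c _ => Finset.mem_univ _) ?_
  intro c hc c' hc' h
  have hc := (Finset.mem_filter.1 (Finset.mem_coe.1 hc)).2
  have hc' := (Finset.mem_filter.1 (Finset.mem_coe.1 hc')).2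
  funext κ
  have hκ : decide (p.src κ = c κ) = decide (p.src κ = c' κ) := congrFun h κ
  have hiff : p.src κ = c κ ↔ p.src κ = c' κ := by
    constructor
    · intro h1; by_contra h2; rw [decide_eq_true h1, eq_comm, decide_eq_true_eq] at hκ; exact h2 hκ
    · intro h1; by_contra h2; rw [decide_eq_true h1, decide_eq_true_eq] at hκ; exact h2 hκ
  rcases hc κ with h1 | ⟨-, -, h1⟩
  · exact h1.symm.trans (hiff.1 h1)
  · rcases hc' κ with h2 | ⟨-, -, h2⟩
    · exact (hiff.2 h2).symm.trans h2
    · exact add_right_cancel (h1.symm.trans h2)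


/-- **THE SUM OF ALL CUBE ENERGIES IS AT MOST `2^d` TIMES THE ACTION**: `Σ_c E_c(U) ≤ 2^d · Σ_p (1 − Re tr U(∂p))`. [folklore] -/
theorem sum_cubeEnergy_le (U : GaugeField P 0 (Matrix.specialUnitaryGroup (Fin N) ℂ)) :
    ∑ c : BlockIdx P.d (P.sitesPerDir 0), (∑ p : Plaq P 0, if (∀ κ, p.src κ = c κ ∨ (κ ≠ p.μ ∧ κ ≠ p.ν ∧ p.src κ = c κ + 1)) then (1 - reTr (GaugeField.plaqHol U p)) else 0) ≤
      2 ^ P.d * ∑ p : Plaq P 0, (1 - reTr (GaugeField.plaqHol U p)) := by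
  classical
  rw [Finset.sum_comm, Finset.mul_sum]
  refine Finset.sum_le_sum fun p _ => ?_
  rw [← Finset.sum_filter, Finset.sum_const, nsmul_eq_mul]
  have h0 : 0 ≤ 1 - reTr (GaugeField.plaqHol U p) := (N20LCSRestrictedChessboard.plaqTerm_mem U p).1
  have hcard := card_cubes_le p
  calc ((Finset.univ.filter fun c : BlockIdx P.d (P.sitesPerDir 0) =>
          ∀ κ, p.src κ = c κ ∨ (κ ≠ p.μ ∧ κ ≠ p.ν ∧ p.src κ = c κ + 1)).card : ℝ) * (1 - reTr (GaugeField.plaqHol U p))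
      ≤ (2 ^ P.d : ℕ) * (1 - reTr (GaugeField.plaqHol U p)) :=
        mul_le_mul_of_nonneg_right (by exact_mod_cast hcard) h0
    _ = 2 ^ P.d * (1 - reTr (GaugeField.plaqHol U p)) := by push_cast; ring

end Count

/-! ## §3 CONDITIONAL «LCS-0» FOR CUBE ENERGIES: local exponential moments in the restricted state, uniformly in `β` and the volume -/

section Conditional

/-- **CONDITIONAL LOCAL STABILITY AT LEVEL 0 (cube energies).**  There are `C = C(N)` and `c = c(N) > 0` such that for every `d = 4` parameter
set `P` (torus `T^{(0)}`, side `N₀`), every coupling `β ≥ 4N`, every small-field threshold `ε` with `βε ≥ c`, every `0 ≤ t ≤ β∕32` and every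
finite set `S` of closed unit cubes, in the small-field-RESTRICTED level-0 state (assumed non-null, `⟨∏_p 𝟙[1 − Re tr U(∂p) ≤ ε]⟩ > 0`):

  `⟨∏_{c∈S} e^{t·E_c} · ∏_p 𝟙[1 − Re tr U(∂p) ≤ ε]⟩_{P,β} ∕ ⟨∏_p 𝟙[1 − Re tr U(∂p) ≤ ε]⟩_{P,β} ≤ exp(C · (t∕β) · #S)`,

`E_c = Σ_{p ⊂ [c,c+1]^4} (1 − Re tr U(∂p))` — the exponential moments of the plaquette energies of `#S` unit cubes at the natural scale `1∕β`
CONDITIONED on the global small-field event cost `e^{O(1)·#S}`, uniformly in `β` and in the volume: the LEVEL-0 instance, in the history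
term's own (restricted) state, of the relative∕conditional stability «LCS-j» that row NE7b's re-cut road asks
(`Spine/NE7b/LocalConditionalStability.LocCondStability`; the unrestricted rung 0 is `Spine/NE7b/LocalPlaquetteExpMoments`).  Assembly:
module 11b's chessboard (`chessboard_exp_cubeEnergy`), `Σ_c E_c ≤ 16·Σ_p A_p` (`sum_cubeEnergy_le`), and §1 at `a = 16t∕β`. [folklore] -/
theorem condLCS_exp_cubeEnergy (N : ℕ) [NeZero N] :
    ∃ C c : ℝ, 0 < c ∧ ∀ (P : Params), P.d = 4 → ∀ (β ε t : ℝ), 4 * N ≤ β → c ≤ β * ε → 0 ≤ t → t ≤ β / 32 →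
      0 < Missing.expect (G := Matrix.specialUnitaryGroup (Fin N) ℂ) P β (fun U => ∏ p : Plaq P 0, (if 1 - reTr (GaugeField.plaqHol U p) ≤ ε then (1 : ℝ) else 0)) →
      ∀ S : Finset (BlockIdx P.d (P.sitesPerDir 0)),
        Missing.expect (G := Matrix.specialUnitaryGroup (Fin N) ℂ) P β
            (fun U => (∏ c ∈ S, Real.exp (t * (∑ p : Plaq P 0, if (∀ κ, p.src κ = c κ ∨ (κ ≠ p.μ ∧ κ ≠ p.ν ∧ p.src κ = c κ + 1)) then (1 - reTr (GaugeField.plaqHol U p)) else 0))) * ∏ p : Plaq P 0, (if 1 - reTr (GaugeField.plaqHol U p) ≤ ε then (1 : ℝ) else 0)) /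
          Missing.expect (G := Matrix.specialUnitaryGroup (Fin N) ℂ) P β (fun U => ∏ p : Plaq P 0, (if 1 - reTr (GaugeField.plaqHol U p) ≤ ε then (1 : ℝ) else 0)) ≤
        Real.exp (C * (t / β) * S.card) := by
  obtain ⟨A, c, hc, hglob⟩ := expect_restricted_actionMoment_le N
  refine ⟨32 * A, c, hc, fun P hd β ε t hβ hcε ht0 ht hW S => ?_⟩
  have hNpos : (0 : ℝ) < N := Nat.cast_pos.mpr (Nat.pos_of_ne_zero (NeZero.ne N))
  have hβpos : 0 < β := lt_of_lt_of_le (by positivity) hβ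
  have hβ0 : 0 ≤ β := hβpos.le
  -- the small-field weight `w = 𝟙[· ≤ ε]`
  have hw0 : ∀ s : ℝ, 0 ≤ (if s ≤ ε then (1 : ℝ) else 0) := fun s => by split_ifs <;> norm_num
  have hwm : Measurable fun s : ℝ => (if s ≤ ε then (1 : ℝ) else 0) :=
    Measurable.ite measurableSet_Iic measurable_const measurable_const
  have hwb : ∃ K : ℝ, ∀ s : ℝ, (if s ≤ ε then (1 : ℝ) else 0) ≤ K := ⟨1, fun s => by split_ifs <;> norm_num⟩
  -- (1) the chessboard of module 11b
  have hchess := chessboard_exp_cubeEnergy (N := N) P hβ0 hw0 hwm hwb hW ht0 S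
  refine hchess.trans ?_
  -- (2) the global factor: `Σ_c E_c ≤ 16·Σ_p A_p` and §1 at `a = 16t/β`
  set a : ℝ := 16 * t / β with ha_def
  have ha0 : 0 ≤ a := by positivity
  have ha : a ≤ 1 / 2 := by
    rw [ha_def, div_le_iff₀ hβpos]
    linarith
  have hmono : Missing.expect (G := Matrix.specialUnitaryGroup (Fin N) ℂ) P β
        (fun U => (∏ c : BlockIdx P.d (P.sitesPerDir 0), Real.exp (t * (∑ p : Plaq P 0, if (∀ κ, p.src κ = c κ ∨ (κ ≠ p.μ ∧ κ ≠ p.ν ∧ p.src κ = c κ + 1)) then (1 - reTr (GaugeField.plaqHol U p)) else 0))) * ∏ p : Plaq P 0, (if 1 - reTr (GaugeField.plaqHol U p) ≤ ε then (1 : ℝ) else 0)) ≤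
      Missing.expect (G := Matrix.specialUnitaryGroup (Fin N) ℂ) P β
        (fun U => Real.exp (a * β * ∑ p : Plaq P 0, (1 - reTr (GaugeField.plaqHol U p))) * ∏ p : Plaq P 0, (if 1 - reTr (GaugeField.plaqHol U p) ≤ ε then (1 : ℝ) else 0)) := by
    have hFm : ∀ c : BlockIdx P.d (P.sitesPerDir 0), Measurable fun U : GaugeField P 0 (Matrix.specialUnitaryGroup (Fin N) ℂ) =>
        Real.exp (t * (∑ p : Plaq P 0, if (∀ κ, p.src κ = c κ ∨ (κ ≠ p.μ ∧ κ ≠ p.ν ∧ p.src κ = c κ + 1)) then (1 - reTr (GaugeField.plaqHol U p)) else 0)) := fun c =>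
      Real.measurable_exp.comp ((measurable_cubeEnergy c).const_mul t)
    have hSm : Measurable fun U : GaugeField P 0 (Matrix.specialUnitaryGroup (Fin N) ℂ) =>
        ∑ p : Plaq P 0, (1 - reTr (GaugeField.plaqHol U p)) :=
      Finset.measurable_sum _ fun p _ => measurable_const.sub (RegularGaugeGroup.measurable_reTr.comp
        (Missing.measurable_plaqHol (G := Matrix.specialUnitaryGroup (Fin N) ℂ) p))
    have hS0 : ∀ U : GaugeField P 0 (Matrix.specialUnitaryGroup (Fin N) ℂ), 0 ≤ ∑ p : Plaq P 0, (1 - reTr (GaugeField.plaqHol U p)) :=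
      fun U => Finset.sum_nonneg fun p _ => (N20LCSRestrictedChessboard.plaqTerm_mem U p).1
    have hSle : ∀ U : GaugeField P 0 (Matrix.specialUnitaryGroup (Fin N) ℂ),
        ∑ p : Plaq P 0, (1 - reTr (GaugeField.plaqHol U p)) ≤ 2 * Fintype.card (Plaq P 0) := fun U =>
      calc ∑ p : Plaq P 0, (1 - reTr (GaugeField.plaqHol U p)) ≤ ∑ _p : Plaq P 0, (2 : ℝ) :=
            Finset.sum_le_sum fun p _ => (N20LCSRestrictedChessboard.plaqTerm_mem U p).2
        _ = 2 * Fintype.card (Plaq P 0) := by rw [Finset.sum_const, Finset.card_univ, nsmul_eq_mul, mul_comm]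
    refine expect_mul_prod_mono (N := N) P hβ0 hw0 hwm hwb (Finset.measurable_prod _ fun c _ => hFm c)
      (Real.measurable_exp.comp (hSm.const_mul _))
      ⟨Real.exp (t * (2 * Fintype.card (Plaq P 0))) ^ (Finset.univ : Finset (BlockIdx P.d (P.sitesPerDir 0))).card, fun U => by
        rw [Finset.abs_prod, ← Finset.prod_const]
        exact Finset.prod_le_prod (fun c _ => abs_nonneg _) fun c _ => by
          rw [abs_of_nonneg (Real.exp_pos _).le]
          exact Real.exp_le_exp.2 (mul_le_mul_of_nonneg_left (cubeEnergy_mem c U).2 ht0)⟩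
      ⟨Real.exp (a * β * (2 * Fintype.card (Plaq P 0))), fun U => by
        rw [abs_of_nonneg (Real.exp_pos _).le]
        exact Real.exp_le_exp.2 (mul_le_mul_of_nonneg_left (hSle U) (mul_nonneg ha0 hβ0))⟩
      fun U => ?_
    rw [← Real.exp_sum]
    refine Real.exp_le_exp.2 ?_
    rw [← Finset.mul_sum]
    have hd4 : (2 : ℝ) ^ P.d = 16 := by rw [hd]; norm_num
    have h16 := sum_cubeEnergy_le (N := N) U
    rw [hd4] at h16
    calc t * ∑ c : BlockIdx P.d (P.sitesPerDir 0), (∑ p : Plaq P 0, if (∀ κ, p.src κ = c κ ∨ (κ ≠ p.μ ∧ κ ≠ p.ν ∧ p.src κ = c κ + 1)) then (1 - reTr (GaugeField.plaqHol U p)) else 0)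
        ≤ t * (16 * ∑ p : Plaq P 0, (1 - reTr (GaugeField.plaqHol U p))) := mul_le_mul_of_nonneg_left h16 ht0
      _ = a * β * ∑ p : Plaq P 0, (1 - reTr (GaugeField.plaqHol U p)) := by
          rw [ha_def]
          field_simp
  have hglob' := hglob P hd β ε a hβ hcε ha0 ha
  have hψ : Missing.expect (G := Matrix.specialUnitaryGroup (Fin N) ℂ) P β
        (fun U => (∏ c : BlockIdx P.d (P.sitesPerDir 0), Real.exp (t * (∑ p : Plaq P 0, if (∀ κ, p.src κ = c κ ∨ (κ ≠ p.μ ∧ κ ≠ p.ν ∧ p.src κ = c κ + 1)) then (1 - reTr (GaugeField.plaqHol U p)) else 0))) * ∏ p : Plaq P 0, (if 1 - reTr (GaugeField.plaqHol U p) ≤ ε then (1 : ℝ) else 0)) /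
      Missing.expect (G := Matrix.specialUnitaryGroup (Fin N) ℂ) P β (fun U => ∏ p : Plaq P 0, (if 1 - reTr (GaugeField.plaqHol U p) ≤ ε then (1 : ℝ) else 0)) ≤
      Real.exp (2 * a * A * (P.sitesPerDir 0 : ℝ) ^ 4) := by
    rw [div_le_iff₀ hW]
    exact hmono.trans hglob'
  have hψ0 : 0 ≤ Missing.expect (G := Matrix.specialUnitaryGroup (Fin N) ℂ) P β
        (fun U => (∏ c : BlockIdx P.d (P.sitesPerDir 0), Real.exp (t * (∑ p : Plaq P 0, if (∀ κ, p.src κ = c κ ∨ (κ ≠ p.μ ∧ κ ≠ p.ν ∧ p.src κ = c κ + 1)) then (1 - reTr (GaugeField.plaqHol U p)) else 0))) * ∏ p : Plaq P 0, (if 1 - reTr (GaugeField.plaqHol U p) ≤ ε then (1 : ℝ) else 0)) /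
      Missing.expect (G := Matrix.specialUnitaryGroup (Fin N) ℂ) P β (fun U => ∏ p : Plaq P 0, (if 1 - reTr (GaugeField.plaqHol U p) ≤ ε then (1 : ℝ) else 0)) :=
    div_nonneg (expect_mul_prod_nonneg P hβ0 hw0 fun U => Finset.prod_nonneg fun c _ => (Real.exp_pos _).le) hW.le
  -- (3) raise to the volume fraction `#S / N₀^4`
  have hN0 : (0 : ℝ) < (P.sitesPerDir 0 : ℝ) ^ P.d := by
    have : (0 : ℝ) < P.sitesPerDir 0 := by exact_mod_cast Nat.pos_of_ne_zero (P.sitesPerDir_ne_zero 0)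
    positivity
  have hexp0 : 0 ≤ (S.card : ℝ) / (P.sitesPerDir 0 : ℝ) ^ P.d := by positivity
  refine (Real.rpow_le_rpow hψ0 hψ hexp0).trans (le_of_eq ?_)
  have hpow : ((P.sitesPerDir 0 : ℕ) : ℝ) ^ P.d = ((P.sitesPerDir 0 : ℕ) : ℝ) ^ 4 := by rw [hd]
  have hN0' : ((P.sitesPerDir 0 : ℕ) : ℝ) ≠ 0 := by exact_mod_cast P.sitesPerDir_ne_zero 0
  rw [← Real.exp_mul, hpow]
  congr 1
  rw [ha_def]
  field_simp
  ring

end Conditional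

end Summit.QuantumFields.YangMills.BalabanUVNodes.N20LCSConditional

end
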